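import Summits.CriticalPhenomena.SAWScalingLimit.Theses.SAWCircleScreening
import Summits.CriticalPhenomena.SAWScalingLimit.Theorems.SubseqIdentification.Negative.ProbabilityRedundant
import Mathlib.MeasureTheory.Measure.LevyProkhorovMetric
import HarnessLib

/-!
# `SAWCircleScreening.Assembly` (stmt-CriticalPhenomena-5469) — proved

Route `SAWCircleScreening` of `CriticalPhenomena/SAWScalingLimit`, assembly item:

`EndpointCoupling → SomeApproxLimit → SAWScalingLimit`.

* `EndpointCoupling` (EC): for every Dobrushin domain `D` and any two endpoint approximations
  `(a, b)`, `(a', b')` the Lévy–Prokhorov distance between the pushed-forward critical SAW laws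
  `P_δ = law_δ(a_δ, b_δ) ∘ curve⁻¹` and `P'_δ = law_δ(a'_δ, b'_δ) ∘ curve⁻¹` on `CurveClass ℂ` tends
  to `0` as `δ → 0⁺`;
* `SomeApproxLimit` (I₁): for every `D` SOME endpoint approximation `(a', b')` converges in law to
  chordal SLE_{8/3} (`ConvergesInLawToSLE (8/3)`);
* `SAWScalingLimit`: EVERY endpoint approximation converges in law to chordal SLE_{8/3}.

## Proof (converging-together lemma, Billingsley 1999, Thm. 3.1, in Lévy–Prokhorov form)

Fix `D`, `(a, b)`. Take `(a', b')` and the SLE_{8/3} random curve `Γ` from (I₁), so `P'_δ ⇒ μ`,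
`μ` the law of `Γ`. Both families are probability measures for all small `δ > 0`
(`SubseqIdentification.Negative.eventually_isProbabilityMeasure_law`: the endpoints are joined and
`Ω_δ` is finite), and `μ` is a probability measure (test function `1`). On the separable metric
space `CurveClass ℂ` the Lévy–Prokhorov metric metrises weak convergence of probability measures
(Mathlib `LevyProkhorov.continuous_ofMeasure_probabilityMeasure` /
`LevyProkhorov.continuous_toMeasure_probabilityMeasure`), so `d_LP(P'_δ, μ) → 0`; by (EC) and the
triangle inequality `d_LP(P_δ, μ) ≤ d_LP(P_δ, P'_δ) + d_LP(P'_δ, μ) → 0`, hence `P_δ ⇒ μ`, i.e.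
`TendstoLaw` along `(a, b)` with the same `Γ`; measurability is `SAW.aemeasurable_curve`.

The two generic steps are isolated as `tendsto_of_tendsto_levyProkhorovDist` (probability
measures on a separable pseudo-metric space) and `tendstoLaw_of_tendsto_levyProkhorovDist` (the
`TendstoLaw` form along `𝓝[>] 0`, with eventually-probability laws).

## References

* P. Billingsley, *Convergence of Probability Measures*, 2nd ed. (1999), Thm. 3.1 (converging
  together) and §1.2 / p. 72 (the Prokhorov metric metrises weak convergence on separable spaces).
* G. F. Lawler, O. Schramm, W. Werner, *On the scaling limit of planar self-avoiding walk* (2004),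
  §3.4.2 (nearest-point endpoint convention).
-/

noncomputable section

open MeasureTheory Filter Topology Set
open scoped NNReal ENNReal BoundedContinuousFunction
open Literature.Probability.LatticeModels Literature.Probability.RandomPlanarGeometry
  Literature.Probability.RandomPlanarGeometry.SAW

namespace Summit.CriticalPhenomena.SAWScalingLimit.Theorems

namespace SAWCircleScreeningAssembly

/-! ### Converging together in the Lévy–Prokhorov metric -/

/-- **Converging together, Lévy–Prokhorov form.** On a separable pseudo-metric space, if the
probability measures `νᵢ ⇒ μ` weakly and `d_LP(μᵢ, νᵢ) → 0`, then `μᵢ ⇒ μ`: the Lévy–Prokhorov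
metric metrises weak convergence (Mathlib `LevyProkhorov.probabilityMeasureHomeomorph`), so
`d_LP(νᵢ, μ) → 0`, the triangle inequality gives `d_LP(μᵢ, μ) → 0`, and Lévy–Prokhorov convergence
implies weak convergence. [cite: BillingsleyCPM1999, Thm. 3.1] -/
theorem tendsto_of_tendsto_levyProkhorovDist {ι X : Type*} {L : Filter ι} [PseudoMetricSpace X]
    [TopologicalSpace.SeparableSpace X] [MeasurableSpace X] [OpensMeasurableSpace X]
    {μs νs : ι → ProbabilityMeasure X} {μ : ProbabilityMeasure X} (hν : Tendsto νs L (𝓝 μ))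
    (hLP : Tendsto (fun i => levyProkhorovDist (μs i : Measure X) (νs i : Measure X)) L (𝓝 0)) :
    Tendsto μs L (𝓝 μ) := by
  have hν' : Tendsto (fun i => LevyProkhorov.ofMeasure (νs i)) L
      (𝓝 (LevyProkhorov.ofMeasure μ)) :=
    (LevyProkhorov.continuous_ofMeasure_probabilityMeasure.tendsto μ).comp hν
  have hμ' : Tendsto (fun i => LevyProkhorov.ofMeasure (μs i)) L
      (𝓝 (LevyProkhorov.ofMeasure μ)) := by
    rw [tendsto_iff_dist_tendsto_zero] at hν' ⊢
    have h0 : Tendsto (fun i => dist (LevyProkhorov.ofMeasure (μs i))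
        (LevyProkhorov.ofMeasure (νs i))) L (𝓝 0) := by
      simpa only [LevyProkhorov.dist_probabilityMeasure_def] using hLP
    refine squeeze_zero (fun i => dist_nonneg)
      (fun i => dist_triangle _ (LevyProkhorov.ofMeasure (νs i)) _) ?_
    simpa only [zero_add] using h0.add hν'
  simpa only [Function.comp_def] using
    (LevyProkhorov.continuous_toMeasure_probabilityMeasure.tendsto
      (LevyProkhorov.ofMeasure μ)).comp hμ'

/-- If laws `P δ` that are probability measures for all small `δ > 0` converge on bounded
continuous test functions (`TendstoLaw`) to `Z` under `P'`, then `P'` is a probability measure: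
the test function `1` gives `1 → P'.real univ`, and `toReal = 1` excludes `0` and `∞`.
[folklore] -/
theorem isProbabilityMeasure_of_tendstoLaw {Ωδ : ℝ → Type*} [∀ δ, MeasurableSpace (Ωδ δ)]
    {Ω' : Type*} [MeasurableSpace Ω'] {X : Type*} [TopologicalSpace X]
    {Y : ∀ δ, Ωδ δ → X} {P : ∀ δ, Measure (Ωδ δ)} {Z : Ω' → X} {P' : Measure Ω'}
    (hP : ∀ᶠ δ in 𝓝[>] (0 : ℝ), IsProbabilityMeasure (P δ)) (h : TendstoLaw Y P Z P') :
    IsProbabilityMeasure P' := by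
  have h1 := h 1
  simp only [BoundedContinuousFunction.coe_one, Pi.one_apply, integral_const, smul_eq_mul,
    mul_one] at h1
  have h2 : Tendsto (fun δ => (P δ).real univ) (𝓝[>] (0 : ℝ)) (𝓝 1) :=
    tendsto_const_nhds.congr' (hP.mono fun δ hδ => by
      haveI := hδ
      exact probReal_univ.symm)
  have h3 : P'.real univ = 1 := tendsto_nhds_unique h1 h2
  rw [measureReal_def, ENNReal.toReal_eq_one_iff] at h3
  exact ⟨h3⟩

/-- **Converging together for `TendstoLaw` along the mesh.** Two families of random variables
`Y₁ δ`, `Y₂ δ` with values in a separable pseudo-metric space, under laws `P₁ δ`, `P₂ δ` that are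
probability measures for all small `δ > 0`: if `Y₂ δ ⇒ Z` (`TendstoLaw`) and the Lévy–Prokhorov
distance between the laws of `Y₁ δ` and `Y₂ δ` tends to `0` as `δ → 0⁺`, then `Y₁ δ ⇒ Z` with the
same limit variable. The finitely many junk laws are replaced by the limit law before passing to
`ProbabilityMeasure X`, where `tendsto_of_tendsto_levyProkhorovDist` applies.
[cite: BillingsleyCPM1999, Thm. 3.1] -/
theorem tendstoLaw_of_tendsto_levyProkhorovDist
    {Ω₁ Ω₂ : ℝ → Type*} [∀ δ, MeasurableSpace (Ω₁ δ)] [∀ δ, MeasurableSpace (Ω₂ δ)]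
    {Ω' : Type*} [MeasurableSpace Ω'] {X : Type*} [PseudoMetricSpace X]
    [TopologicalSpace.SeparableSpace X] [MeasurableSpace X] [OpensMeasurableSpace X]
    {Y₁ : ∀ δ, Ω₁ δ → X} {P₁ : ∀ δ, Measure (Ω₁ δ)} {Y₂ : ∀ δ, Ω₂ δ → X}
    {P₂ : ∀ δ, Measure (Ω₂ δ)} {Z : Ω' → X} {P' : Measure Ω'}
    (hP₁ : ∀ᶠ δ in 𝓝[>] (0 : ℝ), IsProbabilityMeasure (P₁ δ))
    (hP₂ : ∀ᶠ δ in 𝓝[>] (0 : ℝ), IsProbabilityMeasure (P₂ δ))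
    (hY₁ : ∀ δ, AEMeasurable (Y₁ δ) (P₁ δ)) (hY₂ : ∀ δ, AEMeasurable (Y₂ δ) (P₂ δ))
    (hZ : AEMeasurable Z P') (h₂ : TendstoLaw Y₂ P₂ Z P')
    (hLP : Tendsto (fun δ => levyProkhorovDist ((P₁ δ).map (Y₁ δ)) ((P₂ δ).map (Y₂ δ)))
      (𝓝[>] (0 : ℝ)) (𝓝 0)) :
    TendstoLaw Y₁ P₁ Z P' := by
  classical
  haveI : IsProbabilityMeasure P' := isProbabilityMeasure_of_tendstoLaw hP₂ h₂
  haveI hμP : IsProbabilityMeasure (P'.map Z) := Measure.isProbabilityMeasure_map hZ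
  set μ : ProbabilityMeasure X := ⟨P'.map Z, hμP⟩ with hμ
  -- probability-measure-valued regularisations of the two pushed-forward families
  let ν₁ : ℝ → ProbabilityMeasure X := fun δ =>
    if h : IsProbabilityMeasure ((P₁ δ).map (Y₁ δ)) then ⟨(P₁ δ).map (Y₁ δ), h⟩ else μ
  let ν₂ : ℝ → ProbabilityMeasure X := fun δ =>
    if h : IsProbabilityMeasure ((P₂ δ).map (Y₂ δ)) then ⟨(P₂ δ).map (Y₂ δ), h⟩ else μ
  have e₁ : ∀ᶠ δ in 𝓝[>] (0 : ℝ), (ν₁ δ : Measure X) = (P₁ δ).map (Y₁ δ) := by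
    filter_upwards [hP₁] with δ hδ
    haveI := hδ
    have h : IsProbabilityMeasure ((P₁ δ).map (Y₁ δ)) := Measure.isProbabilityMeasure_map (hY₁ δ)
    simp only [ν₁, dif_pos h, ProbabilityMeasure.coe_mk]
  have e₂ : ∀ᶠ δ in 𝓝[>] (0 : ℝ), (ν₂ δ : Measure X) = (P₂ δ).map (Y₂ δ) := by
    filter_upwards [hP₂] with δ hδ
    haveI := hδ
    have h : IsProbabilityMeasure ((P₂ δ).map (Y₂ δ)) := Measure.isProbabilityMeasure_map (hY₂ δ)
    simp only [ν₂, dif_pos h, ProbabilityMeasure.coe_mk]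
  have hint : ∀ f : X →ᵇ ℝ, ∫ ω, f (Z ω) ∂P' = ∫ x, f x ∂(μ : Measure X) := fun f => by
    rw [hμ, ProbabilityMeasure.coe_mk, integral_map hZ f.continuous.aestronglyMeasurable]
  -- weak convergence of the second family, in `ProbabilityMeasure X`
  have hν₂ : Tendsto ν₂ (𝓝[>] (0 : ℝ)) (𝓝 μ) := by
    rw [ProbabilityMeasure.tendsto_iff_forall_integral_tendsto]
    intro f
    rw [← hint f]
    refine (h₂ f).congr' ?_
    filter_upwards [e₂] with δ hδ
    rw [hδ, integral_map (hY₂ δ) f.continuous.aestronglyMeasurable]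
  -- the Lévy–Prokhorov coupling transfers to the regularised families
  have hLP' : Tendsto (fun δ => levyProkhorovDist (ν₁ δ : Measure X) (ν₂ δ : Measure X))
      (𝓝[>] (0 : ℝ)) (𝓝 0) :=
    hLP.congr' (by filter_upwards [e₁, e₂] with δ h1 h2; rw [h1, h2])
  have hν₁ : Tendsto ν₁ (𝓝[>] (0 : ℝ)) (𝓝 μ) := tendsto_of_tendsto_levyProkhorovDist hν₂ hLP'
  rw [ProbabilityMeasure.tendsto_iff_forall_integral_tendsto] at hν₁
  intro f
  rw [hint f]
  refine (hν₁ f).congr' ?_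
  filter_upwards [e₁] with δ hδ
  rw [hδ, integral_map (hY₁ δ) f.continuous.aestronglyMeasurable]

end SAWCircleScreeningAssembly

open SAWCircleScreeningAssembly in
/-- **`SAWCircleScreening.Assembly` holds** (item stmt-CriticalPhenomena-5469):
`EndpointCoupling → SomeApproxLimit → SAWScalingLimit`. Given `D` and an endpoint approximation
`(a, b)`, `SomeApproxLimit` supplies `(a', b')` and a chordal SLE_{8/3} random curve `Γ` with
`law_δ(a'_δ, b'_δ) ∘ curve⁻¹ ⇒ law(Γ)`; `EndpointCoupling` makes the Lévy–Prokhorov distance of the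
two pushed-forward critical SAW laws tend to `0`; both families are eventually probability
measures; converging together on the separable metric space `CurveClass ℂ`
(`tendstoLaw_of_tendsto_levyProkhorovDist`) gives `law_δ(a_δ, b_δ) ∘ curve⁻¹ ⇒ law(Γ)`, i.e.
`ConvergesInLawToSLE (8/3) D` along `(a, b)`. [cite: BillingsleyCPM1999, Thm. 3.1] -/
theorem assembly_proof :
    Summit.CriticalPhenomena.SAWScalingLimit.Theses.SAWCircleScreening.Assembly := by
  unfold Summit.CriticalPhenomena.SAWScalingLimit.Theses.SAWCircleScreening.Assembly
  intro hEC hSome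
  unfold _root_.SAWScalingLimit Literature.Probability.RandomPlanarGeometry.SAW.SAWScalingLimit
  intro D a b hab
  obtain ⟨a', b', hab', Γ, hΓ, -, hT⟩ := hSome D
  unfold Literature.Probability.RandomPlanarGeometry.ConvergesInLawToSLE
  refine ⟨Γ, hΓ, Eventually.of_forall fun δ => aemeasurable_curve _ _ _ _, ?_⟩
  exact tendstoLaw_of_tendsto_levyProkhorovDist
    (SubseqIdentification.Negative.eventually_isProbabilityMeasure_law hab)
    (SubseqIdentification.Negative.eventually_isProbabilityMeasure_law hab')
    (fun δ => aemeasurable_curve _ _ _ _) (fun δ => aemeasurable_curve _ _ _ _)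
    hΓ.aemeasurable hT (hEC D a b a' b' hab hab')

end Summit.CriticalPhenomena.SAWScalingLimit.Theorems

end
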